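import Literature.NumberTheory.Transcendental.ZudilinOddZeta
import Mathlib.Analysis.Calculus.Deriv.Mul
import Mathlib.Analysis.Complex.RealDeriv
import HarnessLib

/-!
# Zudilin's rational function `Rₙ` over `ℂ`: holomorphy and decay on a right half-plane

Topic `Literature/NumberTheory/Transcendental`; analytic companion of `ZudilinOddZeta.lean`
(`Literature.NumberTheory.Transcendental.Zudilin2004.R`, the very-well-poised rational function of
[Zudilin2004, §8 (8.2), (8.7), Thm. 3] in Fischler's variable `k`). Everything here is PROVED; no
new definitions, no named facts. This is the first input of the analytic half of the proof of
Zudilin's theorem (the asymptotics of the linear forms `Sₙ = ½ Σ R''ₙ(k)`, [Zudilin2004, Lemma 20]):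
the representation of `Sₙ` as a Barnes-type line integral requires `Rₙ` to be holomorphic and
`O(|k|⁻²)` on a right half-plane.

* `Zudilin2004.ofReal_R` — the real and complex incarnations agree: `(Rₙ(x) : ℂ) = Rₙ(x : ℂ)`;
* `Zudilin2004.den_ne_zero`, `Zudilin2004.differentiableOn_R` — the poles of `Rₙ` are the
  integers `−35n, …, −2n`, so `Rₙ` is complex differentiable on `{re k > −1/2}` (`n ≥ 1`);
* `Zudilin2004.norm_R_le` — the crude decay bound `‖Rₙ(k)‖ ≤ Cₙ/(1 + ‖k‖²)` on `{re k > −1/2}`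
  (`n ≥ 1`), with `Cₙ = 8 |normConst n| 64^{162n+1}` (numerator: `162n+1` linear factors each
  `≤ ‖k‖ + 64n`; denominator: `240n+10` factors each `≥ (‖k‖+2n)/2`; only two of them are used for
  the decay, the rest being `≥ 1`).

## References

* [Zudilin2004] W. Zudilin, *Arithmetic of linear forms involving odd zeta values*, J. Théor.
  Nombres Bordeaux 16 (2004), 251–291, §8.
* [Fischler2004] S. Fischler, *Irrationalité de valeurs de zêta*, Sém. Bourbaki exp. 910, §3.3.
-/

noncomputable section

open Finset Complex

namespace Literature.NumberTheory.Transcendental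

namespace Zudilin2004

/-! ### Real versus complex -/

/-- `(Rₙ(x) : ℂ) = Rₙ(x : ℂ)` for real `x`. [cite: Zudilin2004, §8 (8.7)] -/
theorem ofReal_R (n : ℕ) (x : ℝ) : ((R n x : ℝ) : ℂ) = R n (x : ℂ) := by
  unfold R
  push_cast
  ring

/-! ### The denominator does not vanish on `{re k > -1/2}` -/

/-- Each linear factor `k + i` of the denominator, `i ≥ 2n ≥ 2`, satisfies
`‖k + i‖ ≥ (‖k‖ + i)/2 ≥ (‖k‖ + 2n)/2` on `re k > −1/2`. [folklore] -/
theorem norm_add_nat_ge {k : ℂ} (hk : -1 / 2 < k.re) {i : ℕ} (hi : 2 ≤ i) :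
    (‖k‖ + i) / 2 ≤ ‖k + i‖ := by
  have hi' : (2 : ℝ) ≤ i := by exact_mod_cast hi
  -- compare squares
  have h0 : 0 ≤ (‖k‖ + i) / 2 := by positivity
  refine le_of_sq_le_sq ?_ (norm_nonneg _)
  have hn2 : ‖k + i‖ ^ 2 = (k.re + i) ^ 2 + k.im ^ 2 := by
    rw [Complex.sq_norm, Complex.normSq_apply]; simp; ring
  have hk2 : ‖k‖ ^ 2 = k.re ^ 2 + k.im ^ 2 := by
    rw [Complex.sq_norm, Complex.normSq_apply]; ring
  -- `(re k + i)² ≥ 9 i²/16` and `im² = ‖k‖² - re²`, `re² < … `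
  have h1 : (3 * i / 4 : ℝ) ≤ k.re + i := by linarith
  have h2 : (3 * (i : ℝ) / 4) ^ 2 ≤ (k.re + i) ^ 2 := by
    exact pow_le_pow_left₀ (by positivity) h1 2
  have hkn : 0 ≤ ‖k‖ := norm_nonneg k
  -- case split on the sign of `re k`
  rw [hn2, div_pow]
  nlinarith [sq_nonneg (k.re), sq_nonneg (‖k‖ - i), hk2, sq_abs k.re,
    Complex.abs_re_le_norm k, abs_nonneg k.re, sq_nonneg (3 * ‖k‖ - i)]

/-- The denominator of `Rₙ` has no zero on `{re k > −1/2}` when `n ≥ 1`. [folklore] -/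
theorem den_ne_zero {n : ℕ} (hn : 1 ≤ n) {k : ℂ} (hk : -1 / 2 < k.re) :
    (∏ u ∈ Icc 1 10, ∏ i ∈ Icc ((12 - u) * n) ((25 + u) * n), (k + (i : ℂ))) ≠ 0 := by
  refine prod_ne_zero_iff.2 fun u hu ↦ prod_ne_zero_iff.2 fun i hi ↦ ?_
  have hu' := (mem_Icc.1 hu)
  have hi' := (mem_Icc.1 hi).1
  have h2n : 2 * n ≤ (12 - u) * n := Nat.mul_le_mul_right n (by omega)
  have hi2 : 2 ≤ i := by omega
  intro h0
  have := norm_add_nat_ge hk hi2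
  rw [h0, norm_zero] at this
  have : (0 : ℝ) < (‖k‖ + i) / 2 := by positivity
  linarith

/-- `Rₙ` is complex differentiable on `{re k > −1/2}` (`n ≥ 1`). [cite: Zudilin2004, §8 (8.7)] -/
theorem differentiableOn_R {n : ℕ} (hn : 1 ≤ n) :
    DifferentiableOn ℂ (R n : ℂ → ℂ) {k : ℂ | -1 / 2 < k.re} := by
  intro k hk
  have hden := den_ne_zero hn hk
  refine DifferentiableAt.differentiableWithinAt ?_
  unfold R
  refine DifferentiableAt.div ?_ ?_ hden
  · refine ((DifferentiableAt.mul ?_ ?_).mul ?_).mul ?_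
    · exact differentiableAt_const _
    · fun_prop
    · refine (DifferentiableAt.fun_finsetProd fun i _ ↦ ?_).pow 3
      fun_prop
    · refine (DifferentiableAt.fun_finsetProd fun i _ ↦ ?_).pow 3
      fun_prop
  · exact DifferentiableAt.fun_finsetProd fun u _ ↦ DifferentiableAt.fun_finsetProd fun i _ ↦ by
      fun_prop

/-! ### The decay bound -/

/-- Cardinality bookkeeping: `Σ_{u=1}^{10} ((13+2u)n + 1) = 240n + 10`, written as the sum of
the cardinalities of the blocks `[(12-u)n, (25+u)n]`. [folklore] -/
theorem sum_card_blocks (n : ℕ) :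
    ∑ u ∈ Icc 1 10, (Icc ((12 - u) * n) ((25 + u) * n)).card = 240 * n + 10 := by
  have h : ∀ u ∈ Icc 1 10, (Icc ((12 - u) * n) ((25 + u) * n)).card = (13 + 2 * u) * n + 1 := by
    intro u hu
    have hu' := mem_Icc.1 hu
    rw [Nat.card_Icc]
    have hsplit : (25 + u) * n = (13 + 2 * u) * n + (12 - u) * n := by
      rw [← Nat.add_mul]; congr 1; omega
    rw [hsplit]
    generalize (13 + 2 * u) * n = a
    generalize (12 - u) * n = b
    omega
  rw [sum_congr rfl h, sum_add_distrib, ← sum_mul]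
  have h240 : ∑ u ∈ Icc 1 10, (13 + 2 * u) = 240 := by decide
  rw [h240]
  simp

/-- **Crude decay of `Rₙ` on `{re k > −1/2}`** (`n ≥ 1`):
`‖Rₙ(k)‖ ≤ 8 |normConst n| 64^{162n+1} / (1 + ‖k‖²)`. Each of the `162n+1` numerator factors is
`≤ ‖k‖ + 64n ≤ 64 D` and each of the `240n + 10` denominator factors is `≥ D := (‖k‖+2n)/2 ≥ 1`,
and `D² ≥ (1 + ‖k‖²)/4`. [cite: Zudilin2004, §8 (8.3)] -/
theorem norm_R_le {n : ℕ} (hn : 1 ≤ n) {k : ℂ} (hk : -1 / 2 < k.re) :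
    ‖R n k‖ ≤ 8 * |(normConst n : ℝ)| * 64 ^ (162 * n + 1) / (1 + ‖k‖ ^ 2) := by
  set D : ℝ := (‖k‖ + 2 * n) / 2 with hD
  have hn' : (1 : ℝ) ≤ n := by exact_mod_cast hn
  have hD1 : 1 ≤ D := by rw [hD]; linarith [norm_nonneg k]
  have hD0 : 0 < D := by linarith
  set T : ℝ := ‖k‖ + 64 * n with hT
  have hT0 : 0 ≤ T := by positivity
  have hTD : T ≤ 64 * D := by rw [hT, hD]; linarith [norm_nonneg k]
  -- numerator factors
  have hnum1 : ‖(37 * n + 2 * k : ℂ)‖ ≤ 2 * T := by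
    have e1 : ‖(37 * n : ℂ)‖ = 37 * n := by
      rw [show (37 * n : ℂ) = ((37 * n : ℕ) : ℂ) by push_cast; ring, Complex.norm_natCast]
      push_cast; ring
    have e2 : ‖2 * k‖ = 2 * ‖k‖ := by rw [norm_mul]; norm_num
    calc ‖(37 * n + 2 * k : ℂ)‖ ≤ ‖(37 * n : ℂ)‖ + ‖2 * k‖ := norm_add_le _ _
      _ = 37 * n + 2 * ‖k‖ := by rw [e1, e2]
      _ ≤ 2 * T := by rw [hT]; linarith [norm_nonneg k]
  have hnum2 : ∀ i ∈ Icc 1 (27 * n), ‖k - i‖ ≤ T := by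
    intro i hi
    have hi' := (mem_Icc.1 hi).2
    calc ‖k - i‖ ≤ ‖k‖ + ‖(i : ℂ)‖ := norm_sub_le _ _
      _ = ‖k‖ + i := by rw [Complex.norm_natCast]
      _ ≤ T := by
          rw [hT]
          have : (i : ℝ) ≤ 27 * n := by exact_mod_cast hi'
          linarith
  have hnum3 : ∀ i ∈ Icc (37 * n + 1) (64 * n), ‖k + i‖ ≤ T := by
    intro i hi
    have hi' := (mem_Icc.1 hi).2
    calc ‖k + i‖ ≤ ‖k‖ + ‖(i : ℂ)‖ := norm_add_le _ _
      _ = ‖k‖ + i := by rw [Complex.norm_natCast]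
      _ ≤ T := by
          rw [hT]
          have : (i : ℝ) ≤ 64 * n := by exact_mod_cast hi'
          linarith
  -- denominator factors
  have hden1 : ∀ u ∈ Icc 1 10, ∀ i ∈ Icc ((12 - u) * n) ((25 + u) * n), D ≤ ‖k + i‖ := by
    intro u hu i hi
    have hu' := mem_Icc.1 hu
    have hi' := (mem_Icc.1 hi).1
    have h2n : 2 * n ≤ (12 - u) * n := Nat.mul_le_mul_right n (by omega)
    have hi2 : 2 * n ≤ i := h2n.trans hi'
    have hi2' : (2 : ℕ) ≤ i := by omega
    refine le_trans ?_ (norm_add_nat_ge hk hi2')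
    rw [hD]
    have : (2 * n : ℝ) ≤ i := by exact_mod_cast hi2
    linarith
  -- the products
  have hP1 : ‖∏ i ∈ Icc 1 (27 * n), (k - i)‖ ≤ T ^ (27 * n) := by
    rw [norm_prod]
    have := prod_le_prod (s := Icc 1 (27 * n)) (f := fun i : ℕ ↦ ‖k - (i : ℂ)‖)
      (g := fun _ : ℕ ↦ T) (fun i _ ↦ norm_nonneg (k - (i : ℂ))) hnum2
    rwa [prod_const, Nat.card_Icc, show 27 * n + 1 - 1 = 27 * n from rfl] at this
  have hP2 : ‖∏ i ∈ Icc (37 * n + 1) (64 * n), (k + i)‖ ≤ T ^ (27 * n) := by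
    rw [norm_prod]
    have := prod_le_prod (s := Icc (37 * n + 1) (64 * n)) (f := fun i : ℕ ↦ ‖k + (i : ℂ)‖)
      (g := fun _ : ℕ ↦ T) (fun i _ ↦ norm_nonneg (k + (i : ℂ))) hnum3
    rwa [prod_const, Nat.card_Icc, show 64 * n + 1 - (37 * n + 1) = 27 * n by omega] at this
  have hP3 : D ^ (240 * n + 10) ≤ ‖(∏ u ∈ Icc 1 10, ∏ i ∈ Icc ((12 - u) * n) ((25 + u) * n), (k + (i : ℂ)))‖ := by
    rw [norm_prod, ← sum_card_blocks n, ← prod_pow_eq_pow_sum]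
    refine prod_le_prod (fun u _ ↦ by positivity) fun u hu ↦ ?_
    rw [norm_prod]
    have := prod_le_prod (s := Icc ((12 - u) * n) ((25 + u) * n)) (f := fun _ : ℕ ↦ D)
      (g := fun i : ℕ ↦ ‖k + (i : ℂ)‖) (fun i _ ↦ hD0.le) (hden1 u hu)
    rwa [prod_const] at this
  -- assemble: `‖R‖ ≤ |c| (2T) T^{81n} T^{81n} / D^{240n+10}`
  have hc : ‖(normConst n : ℂ)‖ = |(normConst n : ℝ)| := by
    rw [← Complex.ofReal_ratCast, Complex.norm_real, Real.norm_eq_abs]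
  have hDpow : 0 < D ^ (240 * n + 10) := pow_pos hD0 _
  have hden_pos := hDpow.trans_le hP3
  have step1 : ‖R n k‖ ≤ |(normConst n : ℝ)| * (2 * T) * (T ^ (27 * n)) ^ 3 * (T ^ (27 * n)) ^ 3 /
      D ^ (240 * n + 10) := by
    simp only [R]
    rw [norm_div, norm_mul, norm_mul, norm_mul, norm_pow, norm_pow, hc]
    refine div_le_div₀ (by positivity) ?_ hDpow hP3
    have ha : 0 ≤ |(normConst n : ℝ)| := abs_nonneg _
    refine mul_le_mul (mul_le_mul (mul_le_mul_of_nonneg_left hnum1 ha) ?_ (by positivity)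
      (by positivity)) ?_ (by positivity) (by positivity)
    · exact pow_le_pow_left₀ (norm_nonneg _) hP1 3
    · exact pow_le_pow_left₀ (norm_nonneg _) hP2 3
  -- `(2T) T^{162n} ≤ 2 (64 D)^{162 n + 1}` and `D^{240n+10} = D^{162n+1} D^{78n+9} ≥ D^{162n+1} D²`
  have step2 : |(normConst n : ℝ)| * (2 * T) * (T ^ (27 * n)) ^ 3 * (T ^ (27 * n)) ^ 3 /
      D ^ (240 * n + 10) ≤ 2 * |(normConst n : ℝ)| * 64 ^ (162 * n + 1) / D ^ 2 := by
    have hTpow : (2 * T) * (T ^ (27 * n)) ^ 3 * (T ^ (27 * n)) ^ 3 = 2 * T ^ (162 * n + 1) := by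
      ring
    have h64 : T ^ (162 * n + 1) ≤ (64 * D) ^ (162 * n + 1) := pow_le_pow_left₀ hT0 hTD _
    rw [mul_pow] at h64
    have hsplit : D ^ (240 * n + 10) = D ^ (162 * n + 1) * D ^ (78 * n + 9) := by
      rw [← pow_add]; congr 1; ring
    have h78 : D ^ 2 ≤ D ^ (78 * n + 9) := pow_le_pow_right₀ hD1 (by omega)
    rw [mul_assoc (|(normConst n : ℝ)|), mul_assoc (|(normConst n : ℝ)|), hTpow, hsplit,
      div_le_div_iff₀ (by positivity) (by positivity)]
    have ha : 0 ≤ |(normConst n : ℝ)| := abs_nonneg _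
    have hDp : 0 < D ^ (162 * n + 1) := pow_pos hD0 _
    calc |(normConst n : ℝ)| * (2 * T ^ (162 * n + 1)) * D ^ 2
        ≤ |(normConst n : ℝ)| * (2 * ((64:ℝ) ^ (162 * n + 1) * D ^ (162 * n + 1))) *
            D ^ (78 * n + 9) := by
          refine mul_le_mul (mul_le_mul_of_nonneg_left (by linarith) ha) h78 (by positivity)
            (by positivity)
      _ = 2 * |(normConst n : ℝ)| * 64 ^ (162 * n + 1) * (D ^ (162 * n + 1) * D ^ (78 * n + 9)) := by
          ring
  -- `D² ≥ (1 + ‖k‖²)/4`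
  have step3 : 2 * |(normConst n : ℝ)| * 64 ^ (162 * n + 1) / D ^ 2 ≤
      8 * |(normConst n : ℝ)| * 64 ^ (162 * n + 1) / (1 + ‖k‖ ^ 2) := by
    have hD2 : (1 + ‖k‖ ^ 2) / 4 ≤ D ^ 2 := by
      rw [hD]
      nlinarith [norm_nonneg k, hn']
    rw [div_le_div_iff₀ (by positivity) (by positivity)]
    have ha : 0 ≤ 2 * |(normConst n : ℝ)| * 64 ^ (162 * n + 1) := by positivity
    nlinarith [mul_le_mul_of_nonneg_left hD2 ha]
  exact step1.trans (step2.trans step3)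

end Zudilin2004

end Literature.NumberTheory.Transcendental
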